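import Mathlib
import HarnessLib
import HarnessLib.Audit
import Summits.CriticalPhenomena.Statement
import Literature.Probability.Percolation.ArmEvents
import Literature.Probability.Percolation.TwoPointFunction
import Literature.Probability.Percolation.SharpnessDCTProofs

/-!
Route: PercBoostCapacity

CLOSED (retired) 2026-08-15T19:00:27Z by planner-rrepair-CriticalPhenomena-PercBoostCap-72bedd68-g2-0 — reason: not-a-thesis: the only load-bearing hypothesis of closes (SphereEnergyDivergence) is equivalent to PercolationContinuityZ3 with both directions provable now from discharged facts (retriage rev 2 + independent check); 0 load-bearing cruxes,  — note: route-repair (cone, gen 2) acting on payload option (c) after the concurrent retriage verdict (rev 2, 18:47:53Z, "under floor w.r.t. target — 0 load-bearing cruxes; recommend retire not-a-thesis"), independently re-verified: CENSUS. Tried: (1) cone repair — needs-fact none (0/16), the 16 undischarge. The file is kept as the record of this route; refuted decls are indexed as negative knowledge (`ledger negatives`).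

# Route PercBoostCapacity — connection is capacity — one-arm ≤ C·(boost-kernel capacity of the
sphere), and critical sphere energies diverge

It suffices to show X = K1 ∧ K3 (card connection-is-capacity-boost-kernel, sharpened). Notation at p
= p_c(ℤ³): π(R) = P(0 ↔ ∂Λ_R)
(`oneArmProb 3 p_c R`), S_R = ∂Λ_R (`innerBoundary (zdGraph 3) (box 3 R)`), τ(x) = P(0↔x), τ₃(x,y) =
P(0↔x, 0↔y), and for weights ν ≥ 0 on
S_R the touch mass N_ν = Σ ν(x)1{0↔x}, so (E N_ν)² = (Σ ν τ)², E N_ν² = ΣΣ ν ν τ₃; PCap(S_R) :=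
sup_ν (E N_ν)²/E N_ν² = 1/inf_μ Σ μ(x)μ(y)
τ₃(x,y)/(τ(x)τ(y)) is the capacity of the sphere for the BOOST KERNEL K = τ₃/(τ⊗τ) (Lyons–Peres
energy (5.10)). K1 (SphereCapacityBound,
CAP_sphere(ℤ³)): π(R) ≤ C·PCap(S_R) for all R — the weighted second-moment bound π ≥ PCap (LP Prop
5.11, every graph) is SHARP up to a
constant on critical spheres of ℤ³, as it is on trees (Lyons 1992, factor 2) and for every transient
Markov chain (BPP 1995, factor 2).
K3 (SphereEnergyDivergence): PCap(S_R) → 0, i.e. the boost energies of spheres diverge. Then θ(p_c)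
≤ π(R) ≤ C·PCap(S_R) → 0.
Lean: `SphereCapacityBound ∧ SphereEnergyDivergence`

## Assembly
Pure real arithmetic, certified sorry-free in glue.lean (`closes`): θ := θ(p_c) ≥ 0; if θ > 0, take
C from SphereCapacityBound and
ε := θ/(2(|C|+1)) in SphereEnergyDivergence to get R₀; at R = R₀ the K1-weighting ν has π(R₀) ≤
C·a²/b ≤ |C|·(a²/b) ≤ |C|·ε < θ
(a²/b ≤ ε from a² ≤ εb, with Lean's x/0 = 0 covering b = 0), contradicting θ ≤ π(R₀)
(`theta_le_real_siteToBoundary`). Hence θ(p_c) = 0,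
which is `percolationContinuityZ3_iff`. BoundedBoostPotential and CapacityPrinciple enter through
the two provable-now supports.

Rationale: WHY THIS LINE. Percolation's two solvable corners — independent percolation on trees (Lyons1992 =
LyonsPeres2016 §5.6/Thm 5.24, p. 240–241) and hitting
of sets by transient Markov chains (BenjaminiPemantlePeres1995 = LyonsPeres2016 Ex. 16.10, p. 720) —
share one theorem: the probability of
reaching a target is, up to a factor 2, the capacity of the target for a Martin-type kernel; LP p.
240 says reversing the second-moment
bound "depends on a Markov-like structure"; the searches below found no lattice version asked,
conjectured or measured. The card conjectures it for Bernoulli clusters on ℤ³ with the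
model's own 3-point boost τ₃/(τ⊗τ) as Martin kernel, delimits it (canopy graphs break it; Kahn2003's
clique-paths, which break the
FIRST-moment criterion p_cut = p_c off ℤ^d, do not), anchors it where arm exponents are known (d ≥
11: CAP_sphere FOLLOWS from KozmaNachmias2011's
π ≲ R⁻², Hara2008's two-sided τ ≍ |x|^{2−d} and the proved AizenmanNewman1984 tree-graph bound,
which give PCap ≥ 1/𝓔(uniform) ≳ R²/R⁴; in
d = 3 the uniform charge and the Delfino–Viti 3-point form doi:10.1088/1751-8113/44/3/032001 predict
PCap ≍ R^{-β/ν} ≍ π) and MEASURES it: r(R) = π·inf𝓔 = 1.68 ± 0.03 flat for R = 3…23 at p_c on ℤ³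
while π and PCap both fall by 2.7 (card MC). Imported
area: discrete potential theory / Martin capacity (probability on trees), with the explicit
dictionary o↔x ↦ "chain visits x", τ ↦ G(o,·),
K ↦ G(x,y)/G(o,y). What this route adds to the card: the engine is filed ORDER-FREE
(BoundedBoostPotential = a bounded-potential weighting
of mass π(R), the exact content of Lyons' stopping-time step), because a deterministic spatial order
on the sphere makes the card's
ordered-decorrelation OD pointwise false by surface-exponent suppression (see that crux); no prior
route of the sub (48 Theses grepped) uses a
capacity, a hitting kernel or a second-moment reversal, and the negatives index has no statement of
this shape.

RANKED CRUXES. #2 SphereCapacityBound (crux) — CAP_sphere(ℤ³) at p_c (card K1): there is C such that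
for every R some weighting ν ≥ 0 of ∂Λ_R has π(R) ≤ C·(Σ_x ν(x)τ(x))²/ΣΣ ν(x)ν(y)τ₃(x,y) — the
weighted second-moment lower bound for the one-arm event is sharp up to C; equivalently E[N_ν² |
0↔∂Λ_R] ≤ C·E[N_ν | 0↔∂Λ_R]² (bounded conditional coefficient of variation of the touch mass: no
hubs). Degenerate ν gives right side 0 < π(R), R = 0 needs only C ≥ 1. [difficulty: open-problem]
(why it might fail: Needs the Delfino–Viti 3-point form τ₃(0,x,y)≍R^{-2Δ}|x−y|^{-Δ} UNIFORMLY down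
to |x−y|=1 plus hyperscaling π≍R^{-Δ}; a fatter coincident-point singularity or an anomalous one-arm
exponent makes r(R)=π·inf𝓔 grow (canopies: r≈m^0.3); MC flat only to R=23.) [LyonsPeres2016,
Lyons1992, doi:10.1088/1751-8113/44/3/032001, KozmaNachmias2011,
Summits/CriticalPhenomena/PercolationContinuityZ3/Ideas/connection-is-capacity-boost-kernel.md]
#3 BoundedBoostPotential (crux) — the ENGINE, order-free (content of Lyons' stopping-time step LP p.
241 / BPP's Martin-potential bound): there is C₀ such that for every R some weighting ν ≥ 0 of ∂Λ_R
has total τ-mass Σ_y ν(y)τ(y) ≥ π(R) and boost potential Σ_y ν(y)τ₃(x,y) ≤ C₀·τ(x) at EVERY x ∈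
∂Λ_R; i.e. E[N_ν] ≥ P(arm) while E[N_ν | x ∈ C(0)] ≤ C₀ uniformly in the conditioning point x
(pointwise no-hubs). Candidate ν: uniform (predicted by the 3-point scaling form), or the law of the
CHEMICAL first-touch point divided by τ (exploration stopping time: the future of the cluster is
unconstrained — the Markov-like structure LP asks for). One line of algebra gives
SphereCapacityBound with C = C₀ (support PotentialBoundToCapacity). [difficulty: open-problem] (why
it might fail: Stronger than K1 (sup over x, not ν-average; no maximum principle for K). The card's
OD over a deterministic order is pointwise FALSE heuristically: a late far point sits at the edge of
the forbidden membrane, suppression s^-(Δ_edge−Δ) (surface exponents > bulk: DengBlote2005; 2D: 1/3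
vs 5/48).) [LyonsPeres2016, BenjaminiPemantlePeres1995, DengBlote2005, SmirnovWerner2001]
#4 SphereEnergyDivergence (crux) — the conjunct in capacity dress (card K3): PCap_{p_c}(∂Λ_R) → 0,
i.e. for every ε > 0 and all large R, (Σ_x ν(x)τ(x))² ≤ ε·ΣΣ ν(x)ν(y)τ₃(x,y) for EVERY weighting ν ≥
0 of ∂Λ_R — the boost energies inf_μ 𝓔_{p_c}(μ; ∂Λ_R) diverge. NECESSARY for θ(p_c) = 0 (support
EnergyDivergenceOfContinuity, provable now: PCap(S_R) ≤ P(0↔S_R) ≤ π(R−1) → θ) and sufficient given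
SphereCapacityBound (the glue). New attack surface: a quadratic form in the 3-point boost;
sufficient is a diverging boost FLOOR min_{x,y∈∂Λ_R} τ₃(x,y)/(τ(x)τ(y)) → ∞ (conditioning on one
radius-R connection boosts every other by an unbounded factor). [deps: SphereCapacityBound]
[difficulty: open-problem] (why it might fail: Equivalent to the conjunct given K1: false exactly in
a jump world θ(p_c)=θ*>0, where τ→θ*², τ₃→θ*³ floor the boost kernel at 1/θ* and PCap(∂Λ_R)→θ*·O(1);
Harris/FKG give only K ≥ τ(x,y)/τ(y) = O(1), no divergence mechanism is known in d=3.)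
[Grimmett1999, FitznerVanDerHofstad2017, LyonsPeres2016, AizenmanNewman1984]
#5 CapacityPrinciple (crux) — CAP(ℤ³), the card's headline conjecture (Lyons' tree theorem on the
lattice), uniformly in p ∈ [0,1] and in the finite target A ⊂ ℤ³: P_p(0 ↔ A) ≤ C·sup_ν (Σ_A ν
τ_p)²/ΣΣ ν ν τ₃,p. True with C = 2 on every tree (Lyons1992) and for every transient Markov chain
with the Martin kernel (BPP 1995); false on canopy graphs (apex joined to all 2^H leaves of a binary
tree: r ≈ m^{0.3}, card MC); Kahn2003's clique-path graphs, which separate p_cut from p_c, satisfy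
it. Edge cases checked: A = ∅ (0 ≤ 0), 0 ∈ A (ν = δ_0, C ≥ 1), p = 0 (both sides 0), p = 1 (ν
uniform). Implies SphereCapacityBound (support CapacityPrincipleToSphere); its refutation by a
lattice target DELIMITS CAP and does not close the route. [difficulty: open-problem] (why it might
fail: ∀p ∀A is bold: a lattice target mimicking the canopy (a rare gateway into a region where C(0)
then touches a heavy-tailed number of target points), fractal subsets of spheres, or the
near-critical crossover R≈ξ(p) could make P(0↔A)·inf𝓔 unbounded; exact boxes ≤ 4×4, 3×2×2 only give
r ≤ 1.29.) [Lyons1992, BenjaminiPemantlePeres1995, Kahn2003, LyonsPeres2016,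
Summits/CriticalPhenomena/PercolationContinuityZ3/Ideas/connection-is-capacity-boost-kernel.md]
#9 PotentialBoundToCapacity (support) — BoundedBoostPotential → SphereCapacityBound: with the same
ν, ΣΣ ν(x)ν(y)τ₃(x,y) = Σ_x ν(x)·[Σ_y ν(y)τ₃(x,y)] ≤ C₀ Σ_x ν(x)τ(x) =: C₀M and M ≥ π(R), so
C₀(Σντ)²/ΣΣννtτ₃ ≥ C₀M²/(C₀M) = M ≥ π(R); non-degeneracy ΣΣ > 0 from π(R) > 0
(`one_le_mul_oneArmProb_criticalProbI` or τ ≤ π) and τ_{p_c} > 0 (`tau_criticalProbI_pos`), which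
also force C₀ > 0. [difficulty: provable-now] [LyonsPeres2016, BenjaminiPemantlePeres1995]
#9 CapacityPrincipleToSphere (support) — CapacityPrinciple → SphereCapacityBound: specialise p =
p_c, A = ∂Λ_R and use siteToBoundary 3 R ⊆ ⋃_{a ∈ ∂Λ_R} {0 ↔ a} (`openConnIn_subset_openConn`), so
π(R) = oneArmProb ≤ P(⋃ openConn 0 a). [difficulty: provable-now] [LyonsPeres2016, Grimmett1999]
#9 WeightedSecondMoment (support) — the weighted second-moment (Cauchy–Schwarz / Paley–Zygmund at 0)
lower bound of LyonsPeres2016 Prop 5.11 (p. 231) on ℤ^d, any d, p, finite target A and REAL weights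
ν: (Σ_A ν(x)τ_p(0,x))² ≤ P_p(⋃_{a∈A}{0↔a}) · ΣΣ ν(x)ν(y)P_p(0↔x,0↔y), since N_ν = N_ν·1_U. The
unweighted case is `sq_sum_measureReal_le_measureReal_biUnion_mul_sum` (SecondMomentMethod.lean);
same integral-of-a-square proof with weights; measurability from `measurableSet_openConn_holds`. A
Literature-grade lemma for every route that lower-bounds arm or hitting probabilities. [difficulty:
provable-now] [LyonsPeres2016, HeydenreichVanDerHofstad2017]
#9 EnergyDivergenceOfContinuity (support) — PercolationContinuityZ3 → SphereEnergyDivergence (K3 is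
NECESSARY, so the route loses nothing at K3): by WeightedSecondMoment with A = ∂Λ_R, (Σντ)² ≤
P(⋃_{a∈∂Λ_R}{0↔a})·ΣΣννtτ₃, and for R ≥ 1 every a ∈ ∂Λ_R lies outside box(R−1), so ⋃{0↔a} ⊆
siteToBoundary 3 (R−1) a.s. (exit argument of `theta_le_real_siteToBoundary`) whose probability
decreases to θ(p_c) = 0 (`tendsto_real_siteToBoundary`); take R₀ with π(R₀−1) ≤ ε. [difficulty:
provable-now] [LyonsPeres2016, Grimmett1999]

TWO-LAYER PLAN. Foreseen glued splits (none filed now). BoundedBoostPotential ⇐ FirstTouchMass →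
FirstTouchPotential → BoundedBoostPotential with ν_R :=
(law of the chemical-distance-first touch point e* of ∂Λ_R by the exploration of C(0))/τ:
FirstTouchMass is the identity Σ ν τ = π(R);
FirstTouchPotential is "ordered decorrelation on average", Σ_y P(e*=y)P(x∈C | y∈C) ≤ C₀ Σ_y
P(e*=y)P(x∈C | e*=y), to be proved from the
spatial Markov property of the exploration at the stopping time T_{e*} (the unexplored edges are
fresh; the explored chemical ball lies
inside Λ_R and touches the sphere only at e*). SphereEnergyDivergence ⇐ BoostFloorDivergence (min
over sphere pairs of τ₃/(ττ) → ∞) →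
SphereEnergyDivergence (one line). SphereCapacityBound ⇐ ThreePointScalingForm (τ₃ ≤ C
τ(x)τ(y)(R/|x−y|)^Δ-type bound with the one-arm
exponent) → uniform-charge energy bound → SphereCapacityBound. CapacityPrinciple ⇐ subcritical (R ≫
ξ, optimal charge on the ℓ¹-nearest
face) / critical window / supercritical (LLN) regimes, k ≤ 3.

KILL CRITERIA. Refuting SphereCapacityBound (e.g. a proof or certified numerics that r(R) =
π(R)·inf𝓔(∂Λ_R) → ∞ at p_c, or an exponent inequality
forcing it) closes the route `refuted:SphereCapacityBound` and retires the mechanism on ℤ³. Refuting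
BoundedBoostPotential alone forces a
pivot of the engine to the ν-averaged form (K1 directly via the 3-point scaling form). Refuting
CapacityPrinciple (some p, some lattice
target) only delimits CAP: drop it (`--drop CapacityPrinciple`) and record the witness next to the
canopy. SphereEnergyDivergence cannot be
refuted unless PercolationContinuityZ3 is false (EnergyDivergenceOfContinuity). θ(p_c) = 0 on ℤ³
proved elsewhere moots the route but
leaves K1/BoundedBoostPotential/CapacityPrinciple as live statements of independent interest (a
potential theory for critical clusters).

NOT DECOMPOSED YET. The constant-level choice of the optimal charge (off-centre on faces, card MC
1.68 vs 1.79–1.98 uniform); the d ≥ 11 calibration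
CAP_sphere from `KozmaNachmias2011_rhoExHalf` + `Hara2008_etaZeroXSpace` + the proved tree-graph
bound `real_openConnIn_inter_le_sum_tau`
(lattice-sum bookkeeping Σ_u τ(0,u)(Σ_{x∈∂Λ_R}τ(u,x))² ≲ R⁴ — a support item once a prover is idle,
not load-bearing); the definitions
boostKernel/percEnergy/PCap and Lyons' tree theorem as a named Literature fact (definition request
below); the canopy counterexample as a
computed delimiter; any regime split of CapacityPrinciple. All are layer-2 children or Literature
items, filed when a crux moves.

CHEAPEST FALSIFIER. Extend the card's Monte Carlo of r(R) = π(R)·inf_μ𝓔(μ;∂Λ_R) at p_c(ℤ³) =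
0.2488126 beyond R = 23 (R = 32, 45, 64; 10⁴–10⁵ clusters each)
and compute the POINTWISE potential ratio max_x E[N|x∈C]/E[N|arm] for the uniform and the optimal
charge (tests BoundedBoostPotential
directly): growth like R^{0.1} or more in either kills rank 2 / rank 3 respectively; the card's kit
job j002597 (exact 6×3, 4×2×2, canopies
to depth 9) is the zero-cost first look. I could not run kit in plancard mode; the card reports r =
1.62, 1.65, 1.69, 1.68, 1.70, 1.67, 1.70
for R = 3, 4, 6, 8, 11, 16, 23.

NUMBERS. p_c(ℤ³, bond) = 0.2488126 (card MC input). Card MC at p_c: π(R) = 0.540 … 0.206 (slope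
−0.47), PCap(∂Λ_R) = 0.333 … 0.121 (slope −0.50),
r(R) = 1.68 ± 0.03 for R = 3…23; uniform charge r = 1.79–1.98; off-critical p ∈ {0.20, 0.23, 0.27,
0.35}: r ∈ [1.00, 1.90]; exact small
boxes r ≤ 1.29; canopies (s = 0.75): r = 1.18 … 5.50 for m = 4 … 4096 (≈ m^{0.3}). Constants in
print: factor 2 on trees (LyonsPeres2016
Thm 5.24, (5.21)) and for chains (Ex. 16.10: ½cap ≤ P ≤ cap). Exponents: Δ = β/ν ≈ 0.477 (d = 3),
mean-field PCap(∂Λ_R) ≍ R⁻² (d ≥ 11),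
5/48 (d = 2); 2D boundary one-arm 1/3 vs bulk 5/48 (SmirnovWerner2001) is the surface-suppression
that kills pointwise OD. Items at open: 9
(4 cruxes, 4 supports, assembly); X = SphereCapacityBound ∧ SphereEnergyDivergence is carried by the
deciding theorem `closes` (no separate
rank-0 decl: the gate renders rank 0 before the cruxes it would name).

DEFINITION REQUESTS. After open: `ledger workitem add --kind definition --notion percCapacity
--topic Literature/Probability/Percolation` — boostKernel
K_p^o(x,y) = τ₃/(τ⊗τ), percEnergy 𝓔_p(μ;A), PCap_p(o;A) = sup_ν (Σντ)²/ΣΣννtτ₃ over `bondPercolation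
G p` for a finite target, with the
PROVED lemma P_p(o↔A) ≥ PCap (LP Prop 5.11, generalising SecondMomentMethod.lean to weights) and the
NAMED FACT Lyons1992 (trees:
P ≤ 2·PCap, LP Thm 5.24/(5.21)); for WeightedSecondMoment and later CAP items. Bib keys added this
session: Lyons1992,
BenjaminiPemantlePeres1995, Kahn2003.

Novelty: Searches (2026-08-15): `lit search --hybrid "second moment method capacity percolation on trees
Lyons reversing inequality Markov"` (8 books:
LyonsPeres2016 pp. 231, 240–241 read — Prop 5.11, §5.6 "depends on a Markov-like structure", Thm
5.24, Ex. 16.10/p. 829 = BPP 1995; Peres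
St-Flour in Bertoin–Martinelli–Peres 1999); `lit galaxy search "Martin capacity" --star all` (13
rows: LP, Bishop–Peres, Mörters–Peres, Peres
St-Flour, BPP "Random walks in varying dimensions" — all random-walk/Brownian, none for Bernoulli
clusters); `lit galaxy search "capacity of
the percolation cluster" | "hitting probabilities for percolation clusters" --star all` (0, 0); `lit
vsearch "<CAP in prose>"` (8 generic
book hits: Grimmett1999, Slade2006 pp. 130–136 grepped for capacity/hitting: 0); `lit search
--source zbmath "surface critical exponents
three-dimensional percolation"` (1, irrelevant), `--source s2 "surface critical behavior percolation
three dimensions"` (10: Strenski–Bradley–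
Debierre 1991 hull surfaces; Hutchcroft 2025 long-range); `lit frontier CriticalPhenomena --since
2022` (30 rows, none on capacity/hitting;
arXiv:2605.30299 reverses Simon–Lieb in HIGH d only); OpenAlex/S2 partly HTTP 429 (recorded); grep
of all 48 Theses of the sub for
capacit|second.moment|boost|Martin|τ₃|Lyons (only PercTreeValue's amplitude ratios and
PercLevyKhintchine's negative type — different kernels
and payoffs); `ledger negatives` (5; none of this shape).
Nearest prior art found: LyonsPeres2016 Prop 5.1  [refs: 2605.30299, LyonsPeres2016, Grimmett1999, Lyons1992, BenjaminiPemantlePeres1995, Kahn2003, KozmaNachmias2011]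

Barriers (technique_class: second-moment-reversal, boost-kernel-capacity): - technique_class: second-moment-reversal, boost-kernel-capacity
- Literature.Barriers.CriticalPhenomena.LaceExpansionHighDimension: evaded by construction — CAP
turns whatever (τ, τ₃) are into arm bounds (R⁻² when fed mean-field input, R^{-β/ν} when fed
hyperscaling input) and never bootstraps a small diagram or needs T(p_c) < ∞; in that barrier's own
regime (d ≥ 11) CAP_sphere is equivalent to the KN one-arm bound it records as a positive result.
- Literature.Barriers.CriticalPhenomena.GaussianDominationRoute: orthogonal — no infrared bound,
reflection positivity or sign of η is used or produced.
- Literature.Barriers.CriticalPhenomena.TreesPercolatingAtCriticality: applies as CALIBRATION, not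
evaded: CAP holds (factor 2) on every tree including the spherically symmetric trees that percolate
at p_c, so K1/BoundedBoostPotential/CapacityPrinciple alone prove no continuity; the conjunct is
carried by SphereEnergyDivergence, which uses ℤ³ (it is the statement that fails on those trees).
- Literature.Barriers.CriticalPhenomena.LongRangeDiscontinuity: consistent — on the 1/r² model CAP
presumably holds with a floored kernel at β_c; the jump there is killed by nothing in this route,
exactly as SphereEnergyDivergence would fail there; the bet is that ℤ³ nearest-neighbour has
diverging boost floors.
- Literature.Barriers.CriticalPhenomena.SpanningClustersAboveSix: consistent — proliferation of
spanning clusters in d > 6 concerns the NUMBER of clusters; CAP concerns the touch mass of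

History (route lifecycle, newest last):
- 2026-08-15T19:00:27Z · CLOSED retired — not-a-thesis: the only load-bearing hypothesis of closes (SphereEnergyDivergence) is equivalent to PercolationContinuityZ3 with both directions provable now from discharged facts (retriage rev 2 + ind (planner-rrepair-CriticalPhenomena-PercBoostCap-72bedd68-g2-0)

sub-problem: PercolationContinuityZ3 · status: closed(retired) · opened planner-plancard-CriticalPhenomena-Percolatio-d716bbf3-0 2026-08-15T18:19:41Z · rev 3 · ledger route-CriticalPhenomena-PercBoostCapacity
GENERATED by the gate from the ledger (D-0016/17). Provers cite these decls: `theorem foo : Summit.CriticalPhenomena.PercolationContinuityZ3.Theses.PercBoostCapacity.<Decl> := …` in Summits/CriticalPhenomena/PercolationContinuityZ3/Theorems/<Name>.lean.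
-/

namespace Summit.CriticalPhenomena.PercolationContinuityZ3.Theses.PercBoostCapacity

open scoped BigOperators Topology Manifold Classical MeasureTheory ProbabilityTheory Matrix InnerProductSpace ComplexConjugate ContinuousMap
open Filter Set Function TopologicalSpace MeasureTheory

attribute [summit_statement] _root_.PercolationContinuityZ3

/-- item stmt-CriticalPhenomena-11529 · crux · rank 2 · closed · moot by None · by planner
why it might fail: Trivially TRUE if θ(p_c)>0 (ν=1_{x0}, C=1/θ²; so ¬K1 ⇒ the conjunct: irrefutable short of it). If θ(p_c)=0 it needs bounded CV of the touch mass: τ₃≍R^{-2Δ}|x−y|^{-Δ} uniformly down to |x−y|=1 plus π≍R^{-Δ} (hyperscaling); a fatter coincidence singularity gives r(R)=π·inf𝓔→∞; MC flat only to R=23.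
sources: LyonsPeres2016, Lyons1992, Grimmett1999, doi:10.1088/1751-8113/44/3/032001, KozmaNachmias2011, Summits/CriticalPhenomena/PercolationContinuityZ3/Ideas/connection-is-capacity-boost-kernel.md
[crux] CAP_sphere(ℤ³) at p_c (card K1): there is C such that for every R some weighting ν ≥ 0 of
∂Λ_R has π(R) ≤ C·(Σ_x ν(x)τ(x))²/ΣΣ ν(x)ν(y)τ₃(x,y) — the weighted second-moment lower bound for
the one-arm event is sharp up to C; equivalently E[N_ν² | 0↔∂Λ_R] ≤ C·E[N_ν | 0↔∂Λ_R]² (bounded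
conditional coefficient of variation of the touch mass: no hubs). Degenerate ν gives right side 0 <
π(R), R = 0 needs only C ≥ 1. [difficulty: open-problem] -/
@[route_item "route-CriticalPhenomena-PercBoostCapacity"]
def SphereCapacityBound : Prop :=
  ∃ C : ℝ, ∀ R : ℕ, ∃ ν : Literature.Probability.LatticeModels.Site 3 → ℝ, (∀ x, 0 ≤ ν x) ∧ Literature.Probability.Percolation.oneArmProb 3 (Literature.Probability.Percolation.criticalProbI 3) R ≤ C * (∑ x ∈ Literature.Probability.LatticeModels.innerBoundary (Literature.Probability.LatticeModels.zdGraph 3) (Literature.Probability.LatticeModels.box 3 R), ν x * Literature.Probability.Percolation.tau 3 (Literature.Probability.Percolation.criticalProbI 3) 0 x) ^ 2 / (∑ x ∈ Literature.Probability.LatticeModels.innerBoundary (Literature.Probability.LatticeModels.zdGraph 3) (Literature.Probability.LatticeModels.box 3 R), ∑ y ∈ Literature.Probability.LatticeModels.innerBoundary (Literature.Probability.LatticeModels.zdGraph 3) (Literature.Probability.LatticeModels.box 3 R), ν x * ν y * (Literature.Probability.Percolation.bondPercolation (Literature.Probability.LatticeModels.zdGraph 3) (Literature.Probability.Percolation.criticalProbI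 3)).real (Literature.Probability.Percolation.openConn 0 x ∩ Literature.Probability.Percolation.openConn 0 y))

/-- item stmt-CriticalPhenomena-11530 · crux · rank 3 · closed · moot by None · by planner
why it might fail: Trivially TRUE if θ(p_c)>0 (ν=1_{x0}/θ²; irrefutable short of the conjunct). If θ(p_c)=0: stronger than K1 (sup over x, no maximum principle for K=τ₃/τ⊗τ); cube edges/corners and |x−y|=O(1) pairs may be hubs; ordered decorrelation is pointwise false by surface-exponent suppression (DengBlote2005).
sources: LyonsPeres2016, BenjaminiPemantlePeres1995, Grimmett1999, DengBlote2005, SmirnovWerner2001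
[crux] the ENGINE, order-free (content of Lyons' stopping-time step LP p. 241 / BPP's
Martin-potential bound): there is C₀ such that for every R some weighting ν ≥ 0 of ∂Λ_R has total
τ-mass Σ_y ν(y)τ(y) ≥ π(R) and boost potential Σ_y ν(y)τ₃(x,y) ≤ C₀·τ(x) at EVERY x ∈ ∂Λ_R; i.e.
E[N_ν] ≥ P(arm) while E[N_ν | x ∈ C(0)] ≤ C₀ uniformly in the conditioning point x (pointwise
no-hubs). Candidate ν: uniform (predicted by the 3-point scaling form), or the law of the CHEMICAL
first-touch point divided by τ (exploration stopping time: the future of the cluster is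
unconstrained — the Markov-like structure LP asks for). One line of algebra gives
SphereCapacityBound with C = C₀ (support PotentialBoundToCapacity). [difficulty: open-problem] -/
@[route_item "route-CriticalPhenomena-PercBoostCapacity"]
def BoundedBoostPotential : Prop :=
  ∃ C₀ : ℝ, ∀ R : ℕ, ∃ ν : Literature.Probability.LatticeModels.Site 3 → ℝ, (∀ x, 0 ≤ ν x) ∧ Literature.Probability.Percolation.oneArmProb 3 (Literature.Probability.Percolation.criticalProbI 3) R ≤ ∑ y ∈ Literature.Probability.LatticeModels.innerBoundary (Literature.Probability.LatticeModels.zdGraph 3) (Literature.Probability.LatticeModels.box 3 R), ν y * Literature.Probability.Percolation.tau 3 (Literature.Probability.Percolation.criticalProbI 3) 0 y ∧ ∀ x ∈ Literature.Probability.LatticeModels.innerBoundary (Literature.Probability.LatticeModels.zdGraph 3) (Literature.Probability.LatticeModels.box 3 R), ∑ y ∈ Literature.Probability.LatticeModels.innerBoundary (Literature.Probability.LatticeModels.zdGraph 3) (Literature.Probability.LatticeModels.box 3 R), ν y * (Literature.Probability.Percolation.bondPercolation (Literature.Probability.LatticeModels.zdGraph 3) (Literature.Probability.Percolation.criticalProbI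 3)).real (Literature.Probability.Percolation.openConn 0 x ∩ Literature.Probability.Percolation.openConn 0 y) ≤ C₀ * Literature.Probability.Percolation.tau 3 (Literature.Probability.Percolation.criticalProbI 3) 0 x

/-- item stmt-CriticalPhenomena-11532 · crux · rank 5 · closed · moot by None · by planner
why it might fail: ∀p ∀A is bold (a jump trivialises only p≥p_c): canopy-like lattice targets (rare gateway, then heavy-tailed touch count), fractal subsets of spheres, or R≫ξ(p)→∞ as p↑p_c (needs bounded CV of the face-touch count of a scale-ξ tip) may make P(0↔A)·inf𝓔 unbounded; exact small boxes give only r≤1.29.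
sources: Lyons1992, BenjaminiPemantlePeres1995, Kahn2003, LyonsPeres2016, Summits/CriticalPhenomena/PercolationContinuityZ3/Ideas/connection-is-capacity-boost-kernel.md
[crux] CAP(ℤ³), the card's headline conjecture (Lyons' tree theorem on the lattice), uniformly in p
∈ [0,1] and in the finite target A ⊂ ℤ³: P_p(0 ↔ A) ≤ C·sup_ν (Σ_A ν τ_p)²/ΣΣ ν ν τ₃,p. True with C
= 2 on every tree (Lyons1992) and for every transient Markov chain with the Martin kernel (BPP
1995); false on canopy graphs (apex joined to all 2^H leaves of a binary tree: r ≈ m^{0.3}, card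
MC); Kahn2003's clique-path graphs, which separate p_cut from p_c, satisfy it. Edge cases checked: A
= ∅ (0 ≤ 0), 0 ∈ A (ν = δ_0, C ≥ 1), p = 0 (both sides 0), p = 1 (ν uniform). Implies
SphereCapacityBound (support CapacityPrincipleToSphere); its refutation by a lattice target DELIMITS
CAP and does not close the route. [difficulty: open-problem] -/
@[route_item "route-CriticalPhenomena-PercBoostCapacity"]
def CapacityPrinciple : Prop :=
  ∃ C : ℝ, ∀ (p : unitInterval) (A : Finset (Literature.Probability.LatticeModels.Site 3)), ∃ ν : Literature.Probability.LatticeModels.Site 3 → ℝ, (∀ x, 0 ≤ ν x) ∧ (Literature.Probability.Percolation.bondPercolation (Literature.Probability.LatticeModels.zdGraph 3) p).real (⋃ a ∈ A, Literature.Probability.Percolation.openConn 0 a) ≤ C * (∑ x ∈ A, ν x * Literature.Probability.Percolation.tau 3 p 0 x) ^ 2 / (∑ x ∈ A, ∑ y ∈ A, ν x * ν y * (Literature.Probability.Percolation.bondPercolation (Literature.Probability.LatticeModels.zdGraph 3) p).real (Literature.Probability.Percolation.openConn 0 x ∩ Literature.Probability.Percolation.openConn 0 y))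

/-- item stmt-CriticalPhenomena-11531 · support · rank 4 · closed · moot by None · by planner
why it might fail: None independent of the target: false iff θ(p_c)(ℤ³)>0, since every ratio (Σντ)²/ΣΣννtτ₃ is ≥ θ(p_c)² (τ₃(x,y)≤τ(y), τ≥θ²) and ≤ P(0↔∂Λ_R)→θ(p_c).
sources: Grimmett1999, LyonsPeres2016, Literature.Probability.Percolation.Grimmett1999_theta_sq_le_openConn_holds, Literature.Barriers.CriticalPhenomena.percolationContinuityZ3_iff_tendsto_tau
[crux] the conjunct in capacity dress (card K3): PCap_{p_c}(∂Λ_R) → 0, i.e. for every ε > 0 and all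
large R, (Σ_x ν(x)τ(x))² ≤ ε·ΣΣ ν(x)ν(y)τ₃(x,y) for EVERY weighting ν ≥ 0 of ∂Λ_R — the boost
energies inf_μ 𝓔_{p_c}(μ; ∂Λ_R) diverge. NECESSARY for θ(p_c) = 0 (support
EnergyDivergenceOfContinuity, provable now: PCap(S_R) ≤ P(0↔S_R) ≤ π(R−1) → θ) and sufficient given
SphereCapacityBound (the glue). New attack surface: a quadratic form in the 3-point boost;
sufficient is a diverging boost FLOOR min_{x,y∈∂Λ_R} τ₃(x,y)/(τ(x)τ(y)) → ∞ (conditioning on one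
radius-R connection boosts every other by an unbounded factor). [deps: SphereCapacityBound]
[difficulty: open-problem] -/
@[route_item "route-CriticalPhenomena-PercBoostCapacity"]
def SphereEnergyDivergence : Prop :=
  ∀ ε : ℝ, 0 < ε → ∃ R₀ : ℕ, ∀ R : ℕ, R₀ ≤ R → ∀ ν : Literature.Probability.LatticeModels.Site 3 → ℝ, (∀ x, 0 ≤ ν x) → (∑ x ∈ Literature.Probability.LatticeModels.innerBoundary (Literature.Probability.LatticeModels.zdGraph 3) (Literature.Probability.LatticeModels.box 3 R), ν x * Literature.Probability.Percolation.tau 3 (Literature.Probability.Percolation.criticalProbI 3) 0 x) ^ 2 ≤ ε * ∑ x ∈ Literature.Probability.LatticeModels.innerBoundary (Literature.Probability.LatticeModels.zdGraph 3) (Literature.Probability.LatticeModels.box 3 R), ∑ y ∈ Literature.Probability.LatticeModels.innerBoundary (Literature.Probability.LatticeModels.zdGraph 3) (Literature.Probability.LatticeModels.box 3 R), ν x * ν y * (Literature.Probability.Percolation.bondPercolation (Literature.Probability.LatticeModels.zdGraph 3) (Literature.Probability.Percolation.criticalProbI 3)).real (Literature.Probability.Percolation.openConn 0 x ∩ Literature.Probability.Percolation.openConn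 0 y)

/-- item stmt-CriticalPhenomena-11533 · support · rank 9 · closed · moot by None · by planner
sources: LyonsPeres2016, BenjaminiPemantlePeres1995
[support] BoundedBoostPotential → SphereCapacityBound: with the same ν, ΣΣ ν(x)ν(y)τ₃(x,y) = Σ_x
ν(x)·[Σ_y ν(y)τ₃(x,y)] ≤ C₀ Σ_x ν(x)τ(x) =: C₀M and M ≥ π(R), so C₀(Σντ)²/ΣΣννtτ₃ ≥ C₀M²/(C₀M) = M ≥
π(R); non-degeneracy ΣΣ > 0 from π(R) > 0 (`one_le_mul_oneArmProb_criticalProbI` or τ ≤ π) and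
τ_{p_c} > 0 (`tau_criticalProbI_pos`), which also force C₀ > 0. [difficulty: provable-now] -/
@[route_item "route-CriticalPhenomena-PercBoostCapacity"]
def PotentialBoundToCapacity : Prop :=
  BoundedBoostPotential → SphereCapacityBound

/-- item stmt-CriticalPhenomena-11534 · support · rank 9 · closed · moot by None · by planner
sources: LyonsPeres2016, Grimmett1999
[support] CapacityPrinciple → SphereCapacityBound: specialise p = p_c, A = ∂Λ_R and use
siteToBoundary 3 R ⊆ ⋃_{a ∈ ∂Λ_R} {0 ↔ a} (`openConnIn_subset_openConn`), so π(R) = oneArmProb ≤ P(⋃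
openConn 0 a). [difficulty: provable-now] -/
@[route_item "route-CriticalPhenomena-PercBoostCapacity"]
def CapacityPrincipleToSphere : Prop :=
  CapacityPrinciple → SphereCapacityBound

/-- item stmt-CriticalPhenomena-11535 · support · rank 9 · closed · moot by None · by planner
sources: LyonsPeres2016, HeydenreichVanDerHofstad2017
[support] the weighted second-moment (Cauchy–Schwarz / Paley–Zygmund at 0) lower bound of
LyonsPeres2016 Prop 5.11 (p. 231) on ℤ^d, any d, p, finite target A and REAL weights ν: (Σ_A
ν(x)τ_p(0,x))² ≤ P_p(⋃_{a∈A}{0↔a}) · ΣΣ ν(x)ν(y)P_p(0↔x,0↔y), since N_ν = N_ν·1_U. The unweighted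
case is `sq_sum_measureReal_le_measureReal_biUnion_mul_sum` (SecondMomentMethod.lean); same
integral-of-a-square proof with weights; measurability from `measurableSet_openConn_holds`. A
Literature-grade lemma for every route that lower-bounds arm or hitting probabilities. [difficulty:
provable-now] -/
@[route_item "route-CriticalPhenomena-PercBoostCapacity"]
def WeightedSecondMoment : Prop :=
  ∀ (d : ℕ) (p : unitInterval) (A : Finset (Literature.Probability.LatticeModels.Site d)) (ν : Literature.Probability.LatticeModels.Site d → ℝ), (∑ x ∈ A, ν x * Literature.Probability.Percolation.tau d p 0 x) ^ 2 ≤ (Literature.Probability.Percolation.bondPercolation (Literature.Probability.LatticeModels.zdGraph d) p).real (⋃ a ∈ A, Literature.Probability.Percolation.openConn 0 a) * ∑ x ∈ A, ∑ y ∈ A, ν x * ν y * (Literature.Probability.Percolation.bondPercolation (Literature.Probability.LatticeModels.zdGraph d) p).real (Literature.Probability.Percolation.openConn 0 x ∩ Literature.Probability.Percolation.openConn 0 y)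

/-- item stmt-CriticalPhenomena-11536 · support · rank 9 · closed · moot by None · by planner
sources: LyonsPeres2016, Grimmett1999
[support] PercolationContinuityZ3 → SphereEnergyDivergence (K3 is NECESSARY, so the route loses
nothing at K3): by WeightedSecondMoment with A = ∂Λ_R, (Σντ)² ≤ P(⋃_{a∈∂Λ_R}{0↔a})·ΣΣννtτ₃, and for
R ≥ 1 every a ∈ ∂Λ_R lies outside box(R−1), so ⋃{0↔a} ⊆ siteToBoundary 3 (R−1) a.s. (exit argument
of `theta_le_real_siteToBoundary`) whose probability decreases to θ(p_c) = 0
(`tendsto_real_siteToBoundary`); take R₀ with π(R₀−1) ≤ ε. [difficulty: provable-now] -/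
@[route_item "route-CriticalPhenomena-PercBoostCapacity"]
def EnergyDivergenceOfContinuity : Prop :=
  PercolationContinuityZ3 → SphereEnergyDivergence

/-- item stmt-CriticalPhenomena-11537 · assembly · rank 1 · closed · moot by None · by planner
sources: Grimmett1999, LyonsPeres2016
[assembly] SphereCapacityBound → SphereEnergyDivergence → PercolationContinuityZ3. -/
@[route_item "route-CriticalPhenomena-PercBoostCapacity"]
def Assembly : Prop :=
  SphereCapacityBound → SphereEnergyDivergence → PercolationContinuityZ3

end Summit.CriticalPhenomena.PercolationContinuityZ3.Theses.PercBoostCapacity
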